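import Literature.Geometry.Lorentzian.CoordTensorCalculus
import HarnessLib

/-!
# The rough d'Alembertian of a coordinate tensor field as a second-order operator in coordinates:
# principal part `g^{jk} ∂_j ∂_k` and explicit lower-order terms

Rank-generic coordinate tensor calculus (`CoordTensorCalculus.lean`: `tcov` = `∇`, `tlap` =
`Σ g^{jk}(∇∇T)_{jk·}`, Christoffel symbols `chrCoef`, inverse metric coefficients `ginv`). Writing
out `∇∇T` with `(∇T)_{kI} = ∂_k T_I − Σ_a Σ_m Γ^m_{k I_a} T_{I[a↦m]}` twice gives, at a point `x` of
an open set `V` on which the metric components are smooth and nondegenerate (`IsMetricOn G V`),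

  `(□T)_I = Σ_{jk} g^{jk} ∂_j∂_k T_I + (lower-order terms)`,

the lower-order terms being a sum of products of the smooth coefficient functions `g^{jk}`,
`Γ^m_{ki}`, `∂_j Γ^m_{ki}` with the components `T_J(x)` and their first derivatives `∂_m T_J(x)`
(O'Neill 1983, Ch. 3, Def. 3.50 ff. for functions; Topping 2006, §2.1, `Δ = tr ∇²`). This file
records exactly this:

* `tcovLower G b x U P j k I`, `tlapLower G b x U P I` — the lower-order parts of `(∇∇T)_{jkI}` and
  of `(□T)_I`, as explicit finite sums, in terms of the `0`-jet `U = T(x)` and the `1`-jet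
  `P m J = ∂_m T_J(x)`; they are linear in `(U, P)` (`tcovLower_zero`, `tlapLower_zero`) and
  jointly smooth in `(x, U, P)` on `V × (jets)` (`IsMetricOn.contDiffOn_tlapLower`);
* `IsMetricOn.tcov_tcov_apply_eq`, **`IsMetricOn.tlap_eq_principal_add_lower`** —
  `(∇∇T)_{jkI} = ∂_j∂_k T_I + tcovLower` and `(□T)_I = Σ g^{jk} ∂_j∂_k T_I + tlapLower` for a
  smooth field `T` on `V`.

So `□` is a linear diagonal second-order operator with principal symbol `g^{jk} ξ_j ξ_k`, the form
to which the uniqueness theorem for second-order hyperbolic systems of the tree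
(`Literature.Analysis.PDE.VarWave.eventually_eq_of_quasilinear_germ`) applies. Everything is
proved; the definitions are explicit sums.

## References

* B. O'Neill, *Semi-Riemannian geometry*, Academic Press 1983, Ch. 3, Def. 3.50. [ONeill1983]
* P. Topping, *Lectures on the Ricci flow*, CUP 2006, §2.1. [Topping2006]
-/

noncomputable section

open Set Filter ContinuousLinearMap Module Function
open scoped Topology ContDiff

namespace Literature.Geometry.Lorentzian

namespace MetricCoord

variable {E : Type*} [NormedAddCommGroup E] [NormedSpace ℝ E] {ι : Type*}

section Defs

variable [Fintype ι] (G : E → E →L[ℝ] E →L[ℝ] ℝ) (b : Basis ι ℝ E) {α : Type*} [Fintype α]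
  [DecidableEq α]

/-- **The lower-order part of `(∇∇T)_{jkI}`** in terms of the jets `U = T(x)`, `P m J = ∂_m T_J(x)`:
`−Σ_a Σ_m (∂_jΓ^m_{kI_a} U_{I[a↦m]} + Γ^m_{kI_a} P_j(I[a↦m])) − Σ_m Γ^m_{jk} (P_m I − Σ_aΣ_n Γ^n_{mI_a} U_{I[a↦n]})
 − Σ_a Σ_m Γ^m_{jI_a} (P_k(I[a↦m]) − Σ_c Σ_n Γ^n_{k (I[a↦m])_c} U_{I[a↦m][c↦n]})`.
[cite: ONeill1983, Ch. 3, Def. 3.50] -/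
def tcovLower (x : E) (U : (α → ι) → ℝ) (P : ι → (α → ι) → ℝ) (j k : ι) (I : α → ι) : ℝ :=
  -(∑ a, ∑ m, (fderiv ℝ (fun y ↦ chrCoef G b y k (I a) m) x (b j) * U (update I a m)
      + chrCoef G b x k (I a) m * P j (update I a m)))
    - ∑ m, chrCoef G b x j k m * (P m I - ∑ a, ∑ n, chrCoef G b x m (I a) n * U (update I a n))
    - ∑ a, ∑ m, chrCoef G b x j (I a) m *
        (P k (update I a m) - ∑ c, ∑ n, chrCoef G b x k (update I a m c) n * U (update (update I a m) c n))

variable [FiniteDimensional ℝ E]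

/-- **The lower-order part of `(□T)_I = Σ g^{jk} (∇∇T)_{jkI}`** in terms of the jets of `T` at `x`.
[cite: ONeill1983, Ch. 3, Def. 3.50] -/
def tlapLower (x : E) (U : (α → ι) → ℝ) (P : ι → (α → ι) → ℝ) (I : α → ι) : ℝ :=
  ∑ j, ∑ k, ginv G b x j k * tcovLower G b x U P j k I

end Defs

section Expansion

variable [Fintype ι] {G : E → E →L[ℝ] E →L[ℝ] ℝ} {b : Basis ι ℝ E} {α : Type*} [Fintype α]
  [DecidableEq α] {V : Set E} {x : E}

/-- The lower-order part of `∇∇` vanishes on the zero jet (linearity). [folklore] -/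
@[simp] theorem tcovLower_zero (x : E) (j k : ι) (I : α → ι) :
    tcovLower G b x (0 : (α → ι) → ℝ) (0 : ι → (α → ι) → ℝ) j k I = 0 := by
  simp [tcovLower]

/-- The lower-order part of `□` vanishes on the zero jet (linearity). [folklore] -/
@[simp] theorem tlapLower_zero [FiniteDimensional ℝ E] (x : E) (I : α → ι) :
    tlapLower G b x (0 : (α → ι) → ℝ) (0 : ι → (α → ι) → ℝ) I = 0 := by
  simp [tlapLower]

/-- **`(∇∇T)_{jkI} = ∂_j∂_k T_I + (lower-order terms)`** at a point of `V` for a smooth field `T`.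
[cite: ONeill1983, Ch. 3, Def. 3.50] -/
theorem IsMetricOn.tcov_tcov_apply_eq [CompleteSpace E] [FiniteDimensional ℝ E] (hG : IsMetricOn G V)
    {T : E → (α → ι) → ℝ} (hT : TSmoothOn T V) (hx : x ∈ V) (j k : ι) (I : α → ι) :
    tcov G b (tcov G b T) x (ocons j (ocons k I)) =
      fderiv ℝ (fderiv ℝ (fun y ↦ T y I)) x (b j) (b k)
        + tcovLower G b x (T x) (fun m J ↦ fderiv ℝ (fun y ↦ T y J) x (b m)) j k I := by
  have hV := hG.isOpen
  -- differentiability of the ingredients at `x`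
  have hTd : ∀ J, DifferentiableAt ℝ (fun y ↦ T y J) x := fun J ↦ hT.differentiableAt hV hx J
  have hΓd : ∀ p i m, DifferentiableAt ℝ (fun y ↦ chrCoef G b y p i m) x := fun p i m ↦
    hG.differentiableAt_chrCoef b hx p i m
  have hT2 : DifferentiableAt ℝ (fderiv ℝ (fun y ↦ T y I)) x :=
    (((hT I).fderiv_of_isOpen (m := ∞) hV (by simp)).contDiffAt (hV.mem_nhds hx)).differentiableAt
      (by simp)
  -- the outer `∇`
  rw [tcov_apply_ocons, Fintype.sum_option]
  simp only [ocons_none, ocons_some, update_ocons_none, update_ocons_some, tcov_apply_ocons]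
  -- the derivative of the inner `∇`
  have hd1 : DifferentiableAt ℝ (fun y ↦ fderiv ℝ (fun z ↦ T z I) y (b k)) x :=
    differentiableAt_clm_apply_const hT2 (b k)
  have hdprod : ∀ a m, DifferentiableAt ℝ (fun y ↦ chrCoef G b y k (I a) m * T y (update I a m)) x :=
    fun a m ↦ (hΓd k (I a) m).mul (hTd _)
  have hdsum_a : ∀ a, DifferentiableAt ℝ (fun y ↦ ∑ m, chrCoef G b y k (I a) m * T y (update I a m)) x :=
    fun a ↦ by
      have := DifferentiableAt.fun_sum (u := Finset.univ) fun m _ ↦ hdprod a m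
      simpa using this
  have hd2 : DifferentiableAt ℝ (fun y ↦ ∑ a, ∑ m, chrCoef G b y k (I a) m * T y (update I a m)) x := by
    have := DifferentiableAt.fun_sum (u := Finset.univ) fun a _ ↦ hdsum_a a
    simpa using this
  rw [fderiv_fun_sub hd1 hd2, _root_.sub_apply, fderiv_clm_apply_const hT2 (b k) (b j),
    fderiv_fun_sum fun a _ ↦ hdsum_a a]
  simp only [FunLike.coe_sum, Finset.sum_apply]
  have hterm : ∀ a m, fderiv ℝ (fun y ↦ chrCoef G b y k (I a) m * T y (update I a m)) x (b j) =
      fderiv ℝ (fun y ↦ chrCoef G b y k (I a) m) x (b j) * T x (update I a m)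
        + chrCoef G b x k (I a) m * fderiv ℝ (fun y ↦ T y (update I a m)) x (b j) := by
    intro a m
    rw [fderiv_fun_mul (hΓd k (I a) m) (hTd _)]
    simp only [_root_.add_apply, _root_.smul_apply, smul_eq_mul]
    ring
  have hsum_a : ∀ a, fderiv ℝ (fun y ↦ ∑ m, chrCoef G b y k (I a) m * T y (update I a m)) x (b j) =
      ∑ m, (fderiv ℝ (fun y ↦ chrCoef G b y k (I a) m) x (b j) * T x (update I a m)
        + chrCoef G b x k (I a) m * fderiv ℝ (fun y ↦ T y (update I a m)) x (b j)) := by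
    intro a
    rw [fderiv_fun_sum fun m _ ↦ hdprod a m, FunLike.coe_sum, Finset.sum_apply]
    exact Finset.sum_congr rfl fun m _ ↦ hterm a m
  simp only [hsum_a, tcovLower]
  simp only [Finset.sum_add_distrib, Finset.mul_sum, mul_sub, Finset.sum_sub_distrib]
  ring

/-- **The rough d'Alembertian in coordinates**: for a smooth field `T` on `V` and `x ∈ V`,
`(□T)_I(x) = Σ_{jk} g^{jk}(x) ∂_j∂_k T_I(x) + tlapLower(x; T(x), ∂T(x))_I` — a linear diagonal
second-order operator with principal symbol `g^{jk} ξ_j ξ_k`. [cite: ONeill1983, Ch. 3, Def. 3.50]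
[cite: Topping2006, §2.1] -/
theorem IsMetricOn.tlap_eq_principal_add_lower [CompleteSpace E] [FiniteDimensional ℝ E]
    (hG : IsMetricOn G V) {T : E → (α → ι) → ℝ} (hT : TSmoothOn T V) (hx : x ∈ V) (I : α → ι) :
    tlap G b T x I =
      ∑ j, ∑ k, ginv G b x j k * fderiv ℝ (fderiv ℝ (fun y ↦ T y I)) x (b j) (b k)
        + tlapLower G b x (T x) (fun m J ↦ fderiv ℝ (fun y ↦ T y J) x (b m)) I := by
  rw [tlap_apply, tlapLower, ← Finset.sum_add_distrib]
  refine Finset.sum_congr rfl fun j _ ↦ ?_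
  rw [← Finset.sum_add_distrib]
  refine Finset.sum_congr rfl fun k _ ↦ ?_
  rw [hG.tcov_tcov_apply_eq hT hx, mul_add]

end Expansion

/-! ### Joint smoothness of the lower-order part in the point and the jets -/

section Smooth

variable {G : E → E →L[ℝ] E →L[ℝ] ℝ} {b : Basis ι ℝ E} {α : Type*} {V : Set E}

/-- The jet space of the lower-order part: `(U, P)`. [folklore] -/
abbrev LapJet (ι α : Type*) : Type _ := ((α → ι) → ℝ) × (ι → (α → ι) → ℝ)

variable [Fintype ι] [Fintype α] [DecidableEq α]

/-- A coefficient smooth on `V` times a continuous linear functional of the jets is jointly smooth on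
`V × jets`. [folklore] -/
theorem contDiffOn_coef_mul_jet {W : Type*} [NormedAddCommGroup W] [NormedSpace ℝ W]
    {f : E → ℝ} (hf : ContDiffOn ℝ ∞ f V) {g : W → ℝ} (hg : ContDiff ℝ ∞ g) :
    ContDiffOn ℝ ∞ (fun q : E × W ↦ f q.1 * g q.2) (V ×ˢ (univ : Set W)) :=
  (hf.comp contDiffOn_fst fun _ hq ↦ (mem_prod.1 hq).1).mul (hg.comp_contDiffOn contDiffOn_snd)

/-- Evaluation of the `0`-jet at an index is smooth. [folklore] -/
theorem contDiff_jet_fst (J : α → ι) : ContDiff ℝ ∞ fun q : LapJet ι α ↦ q.1 J :=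
  (contDiff_apply ℝ ℝ J).comp contDiff_fst

/-- Evaluation of the `1`-jet at a pair of indices is smooth. [folklore] -/
theorem contDiff_jet_snd (m : ι) (J : α → ι) : ContDiff ℝ ∞ fun q : LapJet ι α ↦ q.2 m J :=
  (contDiff_apply_apply ℝ ℝ m J).comp contDiff_snd

/-- **The lower-order part of `∇∇` is jointly smooth in the point and the jets** on `V × jets`.
[folklore] -/
theorem IsMetricOn.contDiffOn_tcovLower [CompleteSpace E] [FiniteDimensional ℝ E] (hG : IsMetricOn G V)
    (j k : ι) (I : α → ι) :
    ContDiffOn ℝ ∞ (fun q : E × LapJet ι α ↦ tcovLower G b q.1 q.2.1 q.2.2 j k I) (V ×ˢ univ) := by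
  have hΓ : ∀ p i m, ContDiffOn ℝ ∞ (fun y ↦ chrCoef G b y p i m) V := fun p i m ↦
    hG.contDiffOn_chrCoef b p i m
  have hdΓ : ∀ p i m (v : E), ContDiffOn ℝ ∞ (fun y ↦ fderiv ℝ (fun z ↦ chrCoef G b z p i m) y v) V :=
    fun p i m v ↦ ((hΓ p i m).fderiv_of_isOpen hG.isOpen (by simp)).clm_apply contDiffOn_const
  -- elementary pieces as functions of `q = (x, U, P)`
  have eΓ : ∀ p i m, ContDiffOn ℝ ∞ (fun q : E × LapJet ι α ↦ chrCoef G b q.1 p i m) (V ×ˢ univ) :=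
    fun p i m ↦ (hΓ p i m).comp contDiffOn_fst fun q hq ↦ (mem_prod.1 hq).1
  have eU : ∀ J, ContDiffOn ℝ ∞ (fun q : E × LapJet ι α ↦ q.2.1 J) (V ×ˢ univ) := fun J ↦
    ((contDiff_jet_fst J).comp contDiff_snd).contDiffOn
  have eP : ∀ m J, ContDiffOn ℝ ∞ (fun q : E × LapJet ι α ↦ q.2.2 m J) (V ×ˢ univ) := fun m J ↦
    ((contDiff_jet_snd m J).comp contDiff_snd).contDiffOn
  have edΓU : ∀ p i m (v : E) J, ContDiffOn ℝ ∞
      (fun q : E × LapJet ι α ↦ fderiv ℝ (fun z ↦ chrCoef G b z p i m) q.1 v * q.2.1 J) (V ×ˢ univ) :=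
    fun p i m v J ↦ contDiffOn_coef_mul_jet (hdΓ p i m v) (contDiff_jet_fst J)
  unfold tcovLower
  refine ((ContDiffOn.neg ?_).sub ?_).sub ?_
  · exact ContDiffOn.sum fun a _ ↦ ContDiffOn.sum fun m _ ↦
      (edΓU k (I a) m (b j) _).add ((eΓ k (I a) m).mul (eP j _))
  · exact ContDiffOn.sum fun m _ ↦ (eΓ j k m).mul ((eP m I).sub
      (ContDiffOn.sum fun a _ ↦ ContDiffOn.sum fun n _ ↦ (eΓ m (I a) n).mul (eU _)))
  · exact ContDiffOn.sum fun a _ ↦ ContDiffOn.sum fun m _ ↦ (eΓ j (I a) m).mul ((eP k _).sub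
      (ContDiffOn.sum fun c _ ↦ ContDiffOn.sum fun n _ ↦ (eΓ k _ n).mul (eU _)))

/-- **The lower-order part of `□` is jointly smooth in the point and the jets** on `V × jets`.
[folklore] -/
theorem IsMetricOn.contDiffOn_tlapLower [CompleteSpace E] [FiniteDimensional ℝ E] (hG : IsMetricOn G V)
    (I : α → ι) :
    ContDiffOn ℝ ∞ (fun q : E × LapJet ι α ↦ tlapLower G b q.1 q.2.1 q.2.2 I) (V ×ˢ univ) := by
  unfold tlapLower
  refine ContDiffOn.sum fun j _ ↦ ContDiffOn.sum fun k _ ↦ ?_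
  exact ((hG.contDiffOn_ginv b j k).comp contDiffOn_fst fun q hq ↦ (mem_prod.1 hq).1).mul
    (hG.contDiffOn_tcovLower j k I)

end Smooth

end MetricCoord

end Literature.Geometry.Lorentzian

end
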